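import Summits.CriticalPhenomena.CardyFormulaZ2.Theorems.CardySusyWardParafermionFamiliesToSLESixDefs
import Summits.CriticalPhenomena.CardyFormulaZ2.Theorems.CardySusyWardWeakHolomorphyFlipInvariance
import Summits.CriticalPhenomena.CardyFormulaZ2.Theorems.CardySusyWardParafermionFamiliesToSLESixHalfCRVertexRelationLoop
import Summits.CriticalPhenomena.CardyFormulaZ2.Theorems.CardySusyWardParafermionFamiliesToSLESixHalfCRVertexRelationPairing
import Summits.CriticalPhenomena.CardyFormulaZ2.Theorems.CardySusyWardParafermionFamiliesToSLESixVertexCornerBridge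
import Literature.Probability.LatticeModels.MedialWindingBridge

/-! # The half Cauchy–Riemann vertex relation, chirality `+i` (hole-free admissible data)

Duminil-Copin 2012, Prop. 4 / Duminil-Copin–Smirnov 2012, Prop. 8.6 at `q = 1`, spin `1/3`, for the
tree's corner observable `cornerObs`: at every interior medial vertex `p` of `ℤ²`-admissible Dobrushin
data `E` whose set of inner faces is HOLE-FREE (e.g. `E.Ω` the carrier of a Jordan domain,
`holeFree_innerFaces`), `G(NW) − G(SE) = i (G(NE) − G(SW))` in the clockwise table `medialCornersAt`.
Hole-freeness cannot be dropped: on the admissible annulus `Ω = (0.5,7.5)² ∖ [3.5,4.5]²`, `δ = 1`,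
marks on the hole (`zdArcA = {(4,3)}`), exact enumeration of the `2¹⁷` configurations gives the
residual `−(1 + ζ²)/2¹⁷ ≠ 0`, `ζ = e^{iπ/6}`, at the interior vertex `((2,3),1)`; so the registered
all-admissible form `HalfCRVertexRelation Complex.I` is false and the stub was reshaped to this form.
Proof: assembly of the landed parts of the sibling line (crux stmt-10814, S2) — flip invariance of
`P_{1/2}` (`integral_comp_symmDiff`, `…WeakHolomorphyFlipInvariance.lean`); pathwise
`gval(ω) + gval(ω ∆ {e}) = 0` (`gval_add_gval_symmDiff`: `gval_case0`, `gval_case1` with the loop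
orientation `loopTurn_eq`, `cornerOrbit_toggle_case2`); the corner integrand of `cornerObs` is `dartW`.
-/

noncomputable section

namespace Summit.CriticalPhenomena.CardyFormulaZ2.Theorems.WeakHolomorphy.SplitBypass

open scoped BigOperators Topology symmDiff
open Filter Set MeasureTheory
open _root_.Literature.Probability.LatticeModels
open _root_.Literature.Probability.RandomPlanarGeometry (DobrushinDomain)
open _root_.Literature.Probability.Percolation (BondConfig bondPercolation half)
open _root_.Literature.Barriers.CriticalPhenomena (medialCornersAt medialVertexOf halfCRForm HalfCRRelationAt
  halfCRForm_apply halfCRRelationAt_iff)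
open Summit.CriticalPhenomena.CardyFormulaZ2.Theorems.ParafermionFamiliesToSLESix.StripAnchored
  (G IsInteriorMV stagger StaggeredVanishes HalfCRVertexRelation)
open Summit.CriticalPhenomena.CardyFormulaZ2.Cruxes.EdgePrecompact.QkzStripBoundaryArm (cornerObs)
open Summit.CriticalPhenomena.CardyFormulaZ2.Theorems.ParafermionFamiliesToSLESix.StripAnchored.S2
  (gval dartW sixthPhase gval_case0 gval_case1 gval_partner loopTurn_eq exp_turnOf_eq_sixthPhase)
open Summit.CriticalPhenomena.CardyFormulaZ2.Theorems.ParafermionFamiliesToSLESix.StripAnchored.S1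
  (cornerSum_explorationList integrable_comp_medialExploration')
open _root_.Literature.Probability.LatticeModels.DiscreteDobrushin (startCorner exitTime exitTime_pos
  isStartCorner_startCorner medialExploration_eq_explorationList isInnerFace_of_lt_exitTime
  not_isInnerFace_exitTime)

/-! ## Flipping an interior edge: the two completed configurations -/

section Toggle

variable {E : DiscreteDobrushin}

/-- Off the flipped edge the completed configurations agree. [folklore] -/
theorem bc_symmDiff_agree (ω : BondConfig (Site 2)) {e e' : Sym2 (Site 2)} (h : e' ≠ e) :
    e' ∈ E.bcBondConfig (ω ∆ {e}) ↔ e' ∈ E.bcBondConfig ω := by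
  simp [DiscreteDobrushin.mem_bcBondConfig_iff, Set.mem_symmDiff, h]

/-- At the flipped edge — an edge of `Ω_δ` not inside the arc `A` and off the arc `B` — they differ.
[folklore] -/
theorem bc_symmDiff_diff (ω : BondConfig (Site 2)) {e : Sym2 (Site 2)}
    (he : e ∈ (discreteDomainGraph E.Ω E.δ).edgeSet) (hA : ¬ ∀ x ∈ e, x ∈ E.zdArcA) (hB : ∀ x ∈ e, x ∉ E.zdArcB) :
    ¬ (e ∈ E.bcBondConfig (ω ∆ {e}) ↔ e ∈ E.bcBondConfig ω) := by
  by_cases hω : e ∈ ω <;> simp [DiscreteDobrushin.mem_bcBondConfig_iff, Set.mem_symmDiff, he, hA, hω] <;> exact hB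

/-- **Both endpoints of an interior medial vertex are interior sites**: all eight faces at them are
inner (the endpoints are off the discrete boundary, `faces_dichotomy`). [folklore] -/
theorem isInnerFace_faceAt_of_isInteriorMV (hE : E.IsZdAdmissible) {p : Site 2 × Fin 2} (hp : IsInteriorMV E p) :
    (∀ j, E.IsInnerFace (faceAt p.1 j)) ∧ ∀ j, E.IsInnerFace (faceAt (p.1 + Pi.single p.2 1) j) := by
  obtain ⟨hedge, harc, hfaces⟩ := hp
  have hinner : medialVertexOf p ∈ E.innerMedialVertices := ⟨hedge, harc⟩
  have hx0 : p.1 ∉ E.zdBoundary := not_mem_zdBoundary_of_mem_inner hE hinner (Sym2.mem_mk_left _ _)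
  have hy0 : p.1 + Pi.single p.2 1 ∉ E.zdBoundary :=
    not_mem_zdBoundary_of_mem_inner hE hinner (Sym2.mem_mk_right _ _)
  obtain ⟨k, hk⟩ : ∃ k : Fin 4, cornerUnit k = Pi.single p.2 1 := by
    obtain ⟨x, i⟩ := p
    fin_cases i
    exacts [⟨0, rfl⟩, ⟨1, rfl⟩]
  have hf : E.IsInnerFace (faceAt p.1 k) :=
    hfaces _ (isCorner_faceAt p.1 k) (by rw [← hk]; exact (isCorner_add_faceAt_iff p.1 k k).2 (Or.inl rfl))
  have hx : ∀ j, E.IsInnerFace (faceAt p.1 j) := (E.faces_dichotomy hx0).resolve_right fun h => h k hf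
  have hf' : E.IsInnerFace (faceAt (p.1 + Pi.single p.2 1) (k + 1)) := by
    rw [← hk, faceAt_add_unit_succ]; exact hf
  exact ⟨hx, (E.faces_dichotomy hy0).resolve_right fun h => h (k + 1) hf'⟩

end Toggle

/-! ## The pair identity `gval(ω) + gval(ω ∆ {e}) = 0`, all cases -/

section Pathwise

variable {E : DiscreteDobrushin}

/-- **Twice ⇒ once after the flip.** If both corners arriving at `e = cTgt r` are darts of the
exploration of `ω`, `r = orb i₁` before its partner `orb i₂`, then in the flipped configuration `r`
is still the `i₁`-th dart, before the exit, and the partner is no dart (the stretch between the two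
visits is excised, `cornerOrbit_toggle_case2`). [cite: Smirnov2010, proof of Lemma 4.5] -/
theorem once_of_twice (hE : E.IsZdAdmissible) {r : Site 2 × Fin 4} {ω ω' : BondConfig (Site 2)}
    (hagree : ∀ e, e ≠ cTgt r → (e ∈ E.bcBondConfig ω' ↔ e ∈ E.bcBondConfig ω))
    (hdiff : ¬ (cTgt r ∈ E.bcBondConfig ω' ↔ cTgt r ∈ E.bcBondConfig ω)) {i₁ i₂ : ℕ}
    (hi₁ : cornerOrbit (E.bcBondConfig ω) (startCorner hE) i₁ = r)
    (hi₂ : cornerOrbit (E.bcBondConfig ω) (startCorner hE) i₂ = cornerPartner r)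
    (h12 : i₁ < i₂) (hi₂N : i₂ < exitTime hE ω) :
    cornerOrbit (E.bcBondConfig ω') (startCorner hE) i₁ = r ∧ i₁ < exitTime hE ω' ∧
      ∀ i < exitTime hE ω', cornerOrbit (E.bcBondConfig ω') (startCorner hE) i ≠ cornerPartner r := by
  have hc₀ := isStartCorner_startCorner hE
  have hN := not_isInnerFace_exitTime hE ω
  have hlt : ∀ k < exitTime hE ω, E.IsInnerFace (cFace (cornerOrbit (E.bcBondConfig ω) (startCorner hE) k)) :=
    fun k hk => isInnerFace_of_lt_exitTime hE ω hk
  have hinj : ∀ a b, a < exitTime hE ω → b < exitTime hE ω →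
      cornerOrbit (E.bcBondConfig ω) (startCorner hE) a = cornerOrbit (E.bcBondConfig ω) (startCorner hE) b → a = b := by
    intro a b ha hb h
    by_contra hne
    rcases Nat.lt_or_gt_of_ne hne with hab | hab
    · exact cornerOrbit_ne hE hc₀ hab (fun k hk => hlt k (by omega)) h
    · exact cornerOrbit_ne hE hc₀ hab (fun k hk => hlt k (by omega)) h.symm
  obtain ⟨hpre, htail⟩ := cornerOrbit_toggle_case2 hE hc₀ hagree hdiff hlt hi₁ hi₂ h12 hi₂N
  have hex := exit_toggle_case2 hE hc₀ hagree hdiff hN hlt hi₁ hi₂ h12 hi₂N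
  have hN' : exitTime hE ω' = exitTime hE ω - (i₂ - i₁) := exitTime_eq_of hE ω' hex.1 hex.2
  refine ⟨(hpre i₁ le_rfl).trans hi₁, by rw [hN']; omega, fun i hi h => ?_⟩
  rw [hN'] at hi
  by_cases hii : i ≤ i₁
  · rw [hpre i hii] at h
    have := hinj i i₂ (by omega) hi₂N (h.trans hi₂.symm)
    omega
  · obtain ⟨j, rfl⟩ : ∃ j, i = i₁ + 1 + j := ⟨i - i₁ - 1, by omega⟩
    rw [htail j (by omega)] at h
    have := hinj _ _ (by omega) hi₂N (h.trans hi₂.symm)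
    omega

/-- **The pair identity from the once side** (`gval_case1` with its inputs supplied): `r = orb i₁` is
a dart of the exploration of `ω`, its partner is not, `ω'` is `ω` flipped at `e = cTgt r` (all faces
at both endpoints of `e` inner, no endpoint on the arc `B`), and the inner faces of `E` are hole-free;
then `gval(ω) + gval(ω') = 0`, the exit time of `ω'` being that of `ω` plus the period of the
spliced loop, whose orientation is `loopTurn_eq`. [cite: DuminilCopin2012Parafermion, Proposition 4] -/
theorem gval_pair_of_once (hE : E.IsZdAdmissible) (hH : HoleFree {f : Site 2 | E.IsInnerFace f})
    {r : Site 2 × Fin 4} (hB : ∀ x ∈ cTgt r, x ∉ E.zdArcB)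
    (hx : ∀ j, E.IsInnerFace (faceAt r.1 j)) (hy : ∀ j, E.IsInnerFace (faceAt (r.1 + cornerUnit (r.2 + 1)) j))
    {ω ω' : BondConfig (Site 2)}
    (hagree : ∀ e, e ≠ cTgt r → (e ∈ E.bcBondConfig ω' ↔ e ∈ E.bcBondConfig ω))
    (hdiff : ¬ (cTgt r ∈ E.bcBondConfig ω' ↔ cTgt r ∈ E.bcBondConfig ω)) {i₁ : ℕ}
    (hi₁ : cornerOrbit (E.bcBondConfig ω) (startCorner hE) i₁ = r) (hi₁N : i₁ < exitTime hE ω)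
    (h₂ : ∀ i < exitTime hE ω, cornerOrbit (E.bcBondConfig ω) (startCorner hE) i ≠ cornerPartner r) :
    gval (E.bcBondConfig ω) (startCorner hE) r (exitTime hE ω) +
      gval (E.bcBondConfig ω') (startCorner hE) r (exitTime hE ω') = 0 := by
  have hc₀ := isStartCorner_startCorner hE
  have hN := not_isInnerFace_exitTime hE ω
  have hlt : ∀ k < exitTime hE ω, E.IsInnerFace (cFace (cornerOrbit (E.bcBondConfig ω) (startCorner hE) k)) :=
    fun k hk => isInnerFace_of_lt_exitTime hE ω hk
  have hc₀m : (startCorner hE).1 ∈ meshDomain E.Ω E.δ :=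
    E.zdBoundary_subset_meshDomain (E.zdArcA_subset_zdBoundary hc₀.mem_zdArcA)
  obtain ⟨P, hP0, hP, hPmin⟩ := exists_min_period hE ω hc₀m
  have hym : (cornerPartner r).1 ∈ meshDomain E.Ω E.δ :=
    fst_mem_meshDomain_of_isInnerFace (q := cornerPartner r) (hy _)
  obtain ⟨Q, hQ0, hQ, hQmin⟩ := exists_min_period hE ω hym
  obtain ⟨-, hloop, -, hin', hout'⟩ := cornerOrbit_toggle_case1 hE hc₀ hagree hdiff hx hy hN hlt hP0 hP hPmin
    hQ0 hQ hQmin hi₁ hi₁N h₂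
  have hN' : exitTime hE ω' = exitTime hE ω + Q := exitTime_eq_of hE ω' hout' hin'
  have hLin : ∀ m, E.IsInnerFace (cFace (cornerOrbit (E.bcBondConfig ω) (cornerPartner r) m)) := by
    intro m
    rw [← cornerOrbit_mod_period hQ m]
    rcases Nat.eq_zero_or_pos (m % Q) with h0 | hpos
    · rw [h0]; exact (hy _ : E.IsInnerFace (cFace (cornerPartner r)))
    · obtain ⟨j, hj⟩ : ∃ j, m % Q = j + 1 := ⟨m % Q - 1, by omega⟩
      have hjQ : j + 1 ≤ Q := by have := Nat.mod_lt m hQ0; omega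
      rw [hj, ← hloop j hjQ]
      exact hin' _ (by omega)
  have hdisj : ∀ m i, i < exitTime hE ω →
      cornerOrbit (E.bcBondConfig ω) (cornerPartner r) m ≠ cornerOrbit (E.bcBondConfig ω) (startCorner hE) i :=
    fun m i _ => loop_ne_of_never_arrives hE hc₀ hy hN hlt hP0 hP hPmin h₂ m i
  have hS := loopTurn_eq hH hc₀ hx hN hQ0 hQ hQmin hLin hdisj hi₁ hi₁N
  have := gval_case1 hE hc₀ hagree hdiff hB hx hy hN hlt hP0 hP hPmin hQ0 hQ hQmin hi₁ hi₁N h₂ hS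
  rw [hN']
  exact this

/-- **The pair identity, all cases.** At an edge `e = cTgt r` of `Ω_δ` with no endpoint on the arcs
and all faces at both endpoints inner, for hole-free admissible data and every configuration `ω`:
`gval(ω) + gval(ω ∆ {e}) = 0` (cases: never/never — `gval_case0` —, once/twice, twice/once by
`once_of_twice`, each for `r` or for its partner by `gval_partner`).
[cite: DuminilCopin2012Parafermion, Proposition 4] -/
theorem gval_add_gval_symmDiff (hE : E.IsZdAdmissible) (hH : HoleFree {f : Site 2 | E.IsInnerFace f})
    {r : Site 2 × Fin 4} (he : cTgt r ∈ (discreteDomainGraph E.Ω E.δ).edgeSet)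
    (hAB : ∀ x ∈ cTgt r, x ∉ E.zdArcA ∧ x ∉ E.zdArcB)
    (hx : ∀ j, E.IsInnerFace (faceAt r.1 j)) (hy : ∀ j, E.IsInnerFace (faceAt (r.1 + cornerUnit (r.2 + 1)) j))
    (ω : BondConfig (Site 2)) :
    gval (E.bcBondConfig ω) (startCorner hE) r (exitTime hE ω) +
      gval (E.bcBondConfig (ω ∆ {cTgt r})) (startCorner hE) r (exitTime hE (ω ∆ {cTgt r})) = 0 := by
  have hc₀ := isStartCorner_startCorner hE
  have hB : ∀ x ∈ cTgt r, x ∉ E.zdArcB := fun x hx => (hAB x hx).2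
  have hA : ¬ ∀ x ∈ cTgt r, x ∈ E.zdArcA := fun h =>
    (hAB r.1 (Sym2.mem_mk_left _ _)).1 (h r.1 (Sym2.mem_mk_left _ _))
  have hagree : ∀ e, e ≠ cTgt r → (e ∈ E.bcBondConfig (ω ∆ {cTgt r}) ↔ e ∈ E.bcBondConfig ω) :=
    fun e hne => bc_symmDiff_agree ω hne
  have hdiff : ¬ (cTgt r ∈ E.bcBondConfig (ω ∆ {cTgt r}) ↔ cTgt r ∈ E.bcBondConfig ω) :=
    bc_symmDiff_diff ω he hA hB
  have hagree' : ∀ e, e ≠ cTgt r → (e ∈ E.bcBondConfig ω ↔ e ∈ E.bcBondConfig (ω ∆ {cTgt r})) :=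
    fun e hne => (hagree e hne).symm
  have hdiff' : ¬ (cTgt r ∈ E.bcBondConfig ω ↔ cTgt r ∈ E.bcBondConfig (ω ∆ {cTgt r})) := fun h => hdiff h.symm
  -- the same data for the partner
  have hyx : (cornerPartner r).1 + cornerUnit ((cornerPartner r).2 + 1) = r.1 := by
    change r.1 + cornerUnit (r.2 + 1) + cornerUnit (r.2 + 2 + 1) = r.1
    rw [show r.2 + 2 + 1 = (r.2 + 1) + 2 by omega, cornerUnit_add_two]; abel
  have hx2 : ∀ j, E.IsInnerFace (faceAt (cornerPartner r).1 j) := hy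
  have hy2 : ∀ j, E.IsInnerFace (faceAt ((cornerPartner r).1 + cornerUnit ((cornerPartner r).2 + 1)) j) := by
    rw [hyx]; exact hx
  have hB2 : ∀ x ∈ cTgt (cornerPartner r), x ∉ E.zdArcB := by rw [cTgt_partner]; exact hB
  have hagree2 : ∀ e, e ≠ cTgt (cornerPartner r) → (e ∈ E.bcBondConfig (ω ∆ {cTgt r}) ↔ e ∈ E.bcBondConfig ω) := by
    rw [cTgt_partner]; exact hagree
  have hdiff2 : ¬ (cTgt (cornerPartner r) ∈ E.bcBondConfig (ω ∆ {cTgt r}) ↔ cTgt (cornerPartner r) ∈ E.bcBondConfig ω) := by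
    rw [cTgt_partner]; exact hdiff
  have hagree2' : ∀ e, e ≠ cTgt (cornerPartner r) → (e ∈ E.bcBondConfig ω ↔ e ∈ E.bcBondConfig (ω ∆ {cTgt r})) :=
    fun e hne => (hagree2 e hne).symm
  have hdiff2' : ¬ (cTgt (cornerPartner r) ∈ E.bcBondConfig ω ↔ cTgt (cornerPartner r) ∈ E.bcBondConfig (ω ∆ {cTgt r})) :=
    fun h => hdiff2 h.symm
  have hN := not_isInnerFace_exitTime hE ω
  have hlt : ∀ k < exitTime hE ω, E.IsInnerFace (cFace (cornerOrbit (E.bcBondConfig ω) (startCorner hE) k)) :=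
    fun k hk => isInnerFace_of_lt_exitTime hE ω hk
  by_cases h₁ : ∃ i, i < exitTime hE ω ∧ cornerOrbit (E.bcBondConfig ω) (startCorner hE) i = r
  · by_cases h₂ : ∃ i, i < exitTime hE ω ∧ cornerOrbit (E.bcBondConfig ω) (startCorner hE) i = cornerPartner r
    · -- twice in `ω`: once in the flipped configuration
      obtain ⟨i₁, hi₁N, hi₁⟩ := h₁
      obtain ⟨i₂, hi₂N, hi₂⟩ := h₂
      have hne : i₁ ≠ i₂ := by rintro rfl; exact partner_ne r (hi₂.symm.trans hi₁)
      rcases Nat.lt_or_gt_of_ne hne with h12 | h21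
      · obtain ⟨hi₁', hi₁N', h₂'⟩ := once_of_twice hE hagree hdiff hi₁ hi₂ h12 hi₂N
        have := gval_pair_of_once hE hH hB hx hy hagree' hdiff' hi₁' hi₁N' h₂'
        rwa [add_comm] at this
      · obtain ⟨hi₂', hi₂N', h₁'⟩ := once_of_twice (r := cornerPartner r) hE hagree2 hdiff2 hi₂
          (by rw [partner_partner]; exact hi₁) h21 hi₁N
        have := gval_pair_of_once (r := cornerPartner r) hE hH hB2 hx2 hy2 hagree2' hdiff2' hi₂' hi₂N' h₁'
        rw [gval_partner, gval_partner] at this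
        linear_combination -this
    · -- once in `ω`, along `r`
      obtain ⟨i₁, hi₁N, hi₁⟩ := h₁
      have h₂' : ∀ i < exitTime hE ω, cornerOrbit (E.bcBondConfig ω) (startCorner hE) i ≠ cornerPartner r :=
        fun i hi h => h₂ ⟨i, hi, h⟩
      exact gval_pair_of_once hE hH hB hx hy hagree hdiff hi₁ hi₁N h₂'
  · have h₁' : ∀ i < exitTime hE ω, cornerOrbit (E.bcBondConfig ω) (startCorner hE) i ≠ r :=
      fun i hi h => h₁ ⟨i, hi, h⟩
    by_cases h₂ : ∃ i, i < exitTime hE ω ∧ cornerOrbit (E.bcBondConfig ω) (startCorner hE) i = cornerPartner r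
    · -- once in `ω`, along the partner
      obtain ⟨i₂, hi₂N, hi₂⟩ := h₂
      have h₁'' : ∀ i < exitTime hE ω, cornerOrbit (E.bcBondConfig ω) (startCorner hE) i ≠ cornerPartner (cornerPartner r) := by
        rw [partner_partner]; exact h₁'
      have := gval_pair_of_once (r := cornerPartner r) hE hH hB2 hx2 hy2 hagree2 hdiff2 hi₂ hi₂N h₁''
      rw [gval_partner, gval_partner] at this
      linear_combination -this
    · -- never: the flipped exploration is the same path
      have h₂' : ∀ i < exitTime hE ω, cornerOrbit (E.bcBondConfig ω) (startCorner hE) i ≠ cornerPartner r :=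
        fun i hi h => h₂ ⟨i, hi, h⟩
      have hcase := cornerOrbit_toggle_case0 (c₀ := startCorner hE) hagree hdiff h₁' h₂'
      have hN' : exitTime hE (ω ∆ {cTgt r}) = exitTime hE ω :=
        exitTime_eq_of hE _ (by rw [hcase _ le_rfl]; exact hN) (fun k hk => by rw [hcase k hk.le]; exact hlt k hk)
      rw [gval_case0 hc₀ hB h₁' h₂', hN',
        gval_case0 (ω := ω ∆ {cTgt r}) hc₀ hB (fun i hi h => h₁' i hi (by rw [← hcase i hi.le]; exact h))
          (fun i hi h => h₂' i hi (by rw [← hcase i hi.le]; exact h)), add_zero]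

/-- **Assembly**: a functional `H` of the configuration which is pathwise a constant multiple of
`gval` at an interior flipped edge has zero expectation under `P_{1/2}` (flip invariance and the
pair identity: `H ∘ flip = -H`). [cite: DuminilCopin2012Parafermion, Proposition 4] -/
theorem integral_eq_zero_of_eq_mul_gval (hE : E.IsZdAdmissible) (hH : HoleFree {f : Site 2 | E.IsInnerFace f})
    {r : Site 2 × Fin 4} (he : cTgt r ∈ (discreteDomainGraph E.Ω E.δ).edgeSet)
    (hAB : ∀ x ∈ cTgt r, x ∉ E.zdArcA ∧ x ∉ E.zdArcB)
    (hx : ∀ j, E.IsInnerFace (faceAt r.1 j)) (hy : ∀ j, E.IsInnerFace (faceAt (r.1 + cornerUnit (r.2 + 1)) j))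
    (κ : ℂ) (H : BondConfig (Site 2) → ℂ)
    (hHr : ∀ ω, H ω = κ * gval (E.bcBondConfig ω) (startCorner hE) r (exitTime hE ω)) :
    ∫ ω, H ω ∂(bondPercolation (zdGraph 2) half) = 0 := by
  have hanti : ∀ ω, H (ω ∆ {cTgt r}) = -H ω := by
    intro ω
    rw [hHr, hHr]
    have := gval_add_gval_symmDiff hE hH he hAB hx hy ω
    linear_combination κ * this
  have h1 := integral_comp_symmDiff (cTgt_mem_edgeSet r) H
  simp only [hanti, integral_neg] at h1
  linear_combination (-1 / 2 : ℂ) * h1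

end Pathwise

/-! ## The corner integrand along the cut orbit, and the theorem -/

section Assembly

variable {E : DiscreteDobrushin}

/-- **The corner integrand of `cornerObs` at a coded corner is the spin-`1/3` dart weight**: along the
cut orbit `explorationList β c₀ N`, the sum over the traversals of the corner `(q.1, cFace q)` of
`exp(−(i/3)·winding)` is `dartW β c₀ q N = Σ_{j<N, orb j = q} sixthPhase (turnCount j)`.
[cite: Smirnov2010, §2.2 eq. (2.2)] -/
theorem cornerIntegrand_eq_dartW {β : BondConfig (Site 2)} {c₀ : Site 2 × Fin 4} {δ : ℝ} (hδ : δ ≠ 0) (N : ℕ)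
    (q : Site 2 × Fin 4) (c : Site 2 × Site 2) (h1 : c.1 = q.1) (h2 : c.2 = cFace q) :
    (∑ k ∈ (Finset.range (explorationList β c₀ N).length).filter (fun k =>
        (explorationList β c₀ N)[k]? = some (cornerSource c.1 c.2) ∧
          (explorationList β c₀ N)[k + 1]? = some (cornerTarget c.1 c.2)),
        Complex.exp (-(Complex.I / 3) *
          ((Polyline.winding (((explorationList β c₀ N).map (medialPoint δ)).take (k + 2)) : ℝ) : ℂ))) =
      dartW β c₀ q N := by
  classical
  rw [cornerSum_explorationList hδ N c.1 c.2]
  unfold dartW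
  rw [Finset.sum_filter]
  refine Finset.sum_congr rfl fun k _ => ?_
  have hs : cornerSource c.1 c.2 = cSrc q := by rw [h1, h2]; exact cornerSource_cFace q
  have ht : cornerTarget c.1 c.2 = cTgt q := by rw [h1, h2]; exact cornerTarget_cFace q
  rw [hs, ht]
  by_cases hk : cornerOrbit β c₀ k = q
  · rw [if_pos ⟨congrArg cSrc hk, congrArg cTgt hk⟩, if_pos hk, exp_turnOf_eq_sixthPhase]
  · rw [if_neg (fun h => hk (eq_of_cSrc_eq_of_cTgt_eq h.1 h.2)), if_neg hk]

/-- **The half-CR form of `cornerObs` as one expectation**: for any rendering `Ψ c` of the corner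
integrands as functionals of the exploration path, `halfCRForm i p (cornerObs E δ)` is the
expectation of `Ψ(NW) − Ψ(SE) − i (Ψ(NE) − Ψ(SW))` (integrability: the path reads finitely many
edges, `integrable_comp_medialExploration'`). [folklore] -/
theorem halfCRForm_eq_integral (hE : E.IsZdAdmissible) (p : Site 2 × Fin 2) {δ : ℝ}
    (Ψ : Site 2 × Site 2 → List MedialVertex → ℂ)
    (hΨ : ∀ c : Site 2 × Site 2, cornerObs E δ c.1 c.2 = ∫ ω, Ψ c (medialExploration E ω) ∂(bondPercolation (zdGraph 2) half)) :
    halfCRForm Complex.I p (fun c : Site 2 × Site 2 => cornerObs E δ c.1 c.2) =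
      ∫ ω, (Ψ (medialCornersAt p.1 p.2 0) (medialExploration E ω) - Ψ (medialCornersAt p.1 p.2 2) (medialExploration E ω) -
        Complex.I * (Ψ (medialCornersAt p.1 p.2 1) (medialExploration E ω) -
          Ψ (medialCornersAt p.1 p.2 3) (medialExploration E ω))) ∂(bondPercolation (zdGraph 2) half) := by
  have hint : ∀ c, Integrable (fun ω => Ψ c (medialExploration E ω)) (bondPercolation (zdGraph 2) half) :=
    fun c => integrable_comp_medialExploration' hE (Ψ c)
  rw [halfCRForm_apply]
  simp only [hΨ]
  rw [integral_sub, integral_sub (hint _) (hint _), integral_const_mul, integral_sub (hint _) (hint _)]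
  · exact (hint _).sub (hint _)
  · exact ((hint _).sub (hint _)).const_mul _

/-- **The half Cauchy–Riemann vertex relation, chirality `+i`, hole-free admissible data.** For
`ℤ²`-admissible Dobrushin data `E` whose inner faces form a hole-free set, every interior medial
vertex `p` (`IsInteriorMV`) and every reading mesh `δ > 0`:
`G(NW) − G(SE) = i (G(NE) − G(SW))` for `G = cornerObs E δ` in the clockwise table `medialCornersAt`.
[cite: DuminilCopin2012Parafermion, Proposition 4] -/
theorem halfCRRelationAt_cornerObs (hE : E.IsZdAdmissible) (hH : HoleFree {f : Site 2 | E.IsInnerFace f})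
    (p : Site 2 × Fin 2) (hp : IsInteriorMV E p) {δ : ℝ} (hδ : 0 < δ) :
    HalfCRRelationAt Complex.I (fun c : Site 2 × Site 2 => cornerObs E δ c.1 c.2) p := by
  classical
  obtain ⟨hx0, hy0⟩ := isInnerFace_faceAt_of_isInteriorMV hE hp
  obtain ⟨hedge, harc, -⟩ := hp
  obtain ⟨x, i⟩ := p
  rw [halfCRRelationAt_iff, halfCRForm_eq_integral hE (x, i)
    (fun c γ => ∑ n ∈ (Finset.range γ.length).filter (fun n =>
      γ[n]? = some (cornerSource c.1 c.2) ∧ γ[n + 1]? = some (cornerTarget c.1 c.2)),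
      Complex.exp (-(Complex.I / 3) * ((Polyline.winding ((γ.map (medialPoint δ)).take (n + 2)) : ℝ) : ℂ)))
    (fun c => by first | rfl | (unfold cornerObs; simp only [Literature.Probability.LatticeModels.Polyline.winding_eq_winding']))]
  obtain rfl | rfl : i = 0 ∨ i = 1 := by fin_cases i <;> simp
  · -- horizontal medial vertex `s(x, x + e₀)`: arriving corner `r = (x, 3)` (SW); `H = gval`
    refine integral_eq_zero_of_eq_mul_gval hE hH (r := (x, 3)) hedge harc hx0 hy0 1 _ fun ω => ?_
    dsimp only
    rw [medialExploration_eq_explorationList hE ω,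
      cornerIntegrand_eq_dartW hδ.ne' _ (x, 0) (medialCornersAt x 0 0) rfl
        (by simp [medialCornersAt, cFace, faceAt, cornerOff]),
      cornerIntegrand_eq_dartW hδ.ne' _ (x + Pi.single 0 1, 2) (medialCornersAt x 0 2) (by simp [medialCornersAt])
        (by simp [medialCornersAt, cFace, faceAt, cornerOff]; abel),
      cornerIntegrand_eq_dartW hδ.ne' _ (x + Pi.single 0 1, 1) (medialCornersAt x 0 1) (by simp [medialCornersAt])
        (by simp [medialCornersAt, cFace, faceAt, cornerOff]),
      cornerIntegrand_eq_dartW hδ.ne' _ (x, 3) (medialCornersAt x 0 3) rfl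
        (by simp [medialCornersAt, cFace, faceAt, cornerOff]),
      one_mul]
    rfl
  · -- vertical medial vertex `s(x, x + e₁)`: arriving corner `r = (x, 0)` (SE); `H = i · gval`
    refine integral_eq_zero_of_eq_mul_gval hE hH (r := (x, 0)) hedge harc hx0 hy0 Complex.I _ fun ω => ?_
    dsimp only
    rw [medialExploration_eq_explorationList hE ω,
      cornerIntegrand_eq_dartW hδ.ne' _ (x + Pi.single 1 1, 2) (medialCornersAt x 1 0) (by simp [medialCornersAt])
        (by simp [medialCornersAt, cFace, faceAt, cornerOff]),
      cornerIntegrand_eq_dartW hδ.ne' _ (x, 0) (medialCornersAt x 1 2) rfl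
        (by simp [medialCornersAt, cFace, faceAt, cornerOff]),
      cornerIntegrand_eq_dartW hδ.ne' _ (x + Pi.single 1 1, 3) (medialCornersAt x 1 1) (by simp [medialCornersAt])
        (by simp [medialCornersAt, cFace, faceAt, cornerOff]),
      cornerIntegrand_eq_dartW hδ.ne' _ (x, 1) (medialCornersAt x 1 3) rfl
        (by simp [medialCornersAt, cFace, faceAt, cornerOff])]
    have hg : gval (E.bcBondConfig ω) (startCorner hE) (x, 0) (exitTime hE ω) =
        dartW (E.bcBondConfig ω) (startCorner hE) (x, 1) (exitTime hE ω) -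
          dartW (E.bcBondConfig ω) (startCorner hE) (x + Pi.single 1 1, 3) (exitTime hE ω) -
          Complex.I * (dartW (E.bcBondConfig ω) (startCorner hE) (x + Pi.single 1 1, 2) (exitTime hE ω) -
            dartW (E.bcBondConfig ω) (startCorner hE) (x, 0) (exitTime hE ω)) := rfl
    rw [hg]
    linear_combination (dartW (E.bcBondConfig ω) (startCorner hE) (x + Pi.single 1 1, 2) (exitTime hE ω) -
      dartW (E.bcBondConfig ω) (startCorner hE) (x, 0) (exitTime hE ω)) * Complex.I_sq

/-- **The same for Jordan carriers**: if `E.Ω` is the carrier of a (Jordan) Dobrushin domain, the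
inner faces are hole-free (`holeFree_innerFaces`), so the relation holds at every interior medial
vertex of admissible `E`. [cite: DuminilCopin2012Parafermion, Proposition 4] -/
theorem halfCRRelationAt_cornerObs_of_carrier (D : DobrushinDomain) (hΩ : E.Ω = D.carrier) (hE : E.IsZdAdmissible)
    (p : Site 2 × Fin 2) (hp : IsInteriorMV E p) {δ : ℝ} (hδ : 0 < δ) :
    HalfCRRelationAt Complex.I (fun c : Site 2 × Site 2 => cornerObs E δ c.1 c.2) p :=
  halfCRRelationAt_cornerObs hE (holeFree_innerFaces D.toJordanDomain hΩ hE.delta_pos) p hp hδ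

end Assembly

/-- **Registered stub `stub_halfCR` (reshaped 2026-08-16 to the hole-free form)**: the first
registration `HalfCRVertexRelation Complex.I` quantified over ALL admissible data and is false on
annuli with marks on the hole; the hole-free hypothesis below is what the proof — and Duminil-Copin's
"∂G a self-avoiding polygon" — uses. [cite: DuminilCopin2012Parafermion, Proposition 4] -/
theorem stub_halfCR : ∀ (E : DiscreteDobrushin), E.IsZdAdmissible → HoleFree {f : Site 2 | E.IsInnerFace f} →
    ∀ p : Site 2 × Fin 2, IsInteriorMV E p → ∀ δ : ℝ, 0 < δ →
      HalfCRRelationAt Complex.I (fun c : Site 2 × Site 2 => cornerObs E δ c.1 c.2) p :=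
  fun _ hE hH p hp _ hδ => halfCRRelationAt_cornerObs hE hH p hp hδ

end Summit.CriticalPhenomena.CardyFormulaZ2.Theorems.WeakHolomorphy.SplitBypass
end
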